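/-
Copyright (c) 2026 the pub-hodgecm-mathlib formalisation cell (harness21).  Prover seat hodgecm-mathlib-F0P3a-p07 (g11): road «S3-tree» (LEAD F0P3a-plan (g11), architect
A-p16 (g29) rulings A-73 (2) ∕ A-78 «S-a3-ram: the tamely ramified twin of S-a3»), brick S-a3-ram, FILE 1 of 2 «RAMIFIED COSTAR COORDINATES»; 2026-09-01.
-/
import Literature.NumberTheory.Automorphic.UnitaryLatticeTreeFixedCostarCoords   -- ★ T2-E′ FILE 3 (F0P2-p06 (g10)): `vec_mem_N₁_iff`, `smul_ϖ_vec_mem_N₁`, `mulVec_vec_sub_vec_mem_N₁`; brings ★ FILE 2 `mapGL_sup_span_eq_iff`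
import HarnessLib

/-!
# The lattice graph of a hermitian space — S-a3-ram FILE 1: COORDINATES ON `N₁^♯ ∕ N₁` WITHOUT `σϖ = ϖ`, AND «AT A RAMIFIED PLACE EVERY NEIGHBOUR OF `N₁` IS SELF-DUAL»
# (Bruhat–Tits 1972 §10; Tits 1979 §3.5; Jacobowitz 1962 §4, §7–§8)

Topic `NumberTheory/Automorphic`; namespace `Literature.NumberTheory.Automorphic.UnitaryLatticeTree`.  THEOREMS ONLY (no definition, no instance, no notation, no named fact,
no `sorry`); kernel lane.  Cell `pub/hodgecm-mathlib` (D-0151), crux H413 = `stmt-HodgeConjecture-24833`; road «S3-tree», brick **S-a3-ram** = the TAMELY RAMIFIED twin of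
S-a3 «a residually unipotent element of a type-two vertex stabiliser fixes a self-dual neighbour» (architect A-73 (2) ∕ A-78; census «S-a3-ram» v0, F0P3a-p07 (g11)).
This FILE 1 is the twin of ★ T2-E′ FILE 3 `UnitaryLatticeTreeFixedCostarCoords` (F0P2-p06 (g10)) with the hypothesis `σϖ = ϖ` REMOVED where it was idle and replaced by
`σϖ = −ϖ` where it matters.
THE MATHEMATICS (`K` with `Valued K ℤᵐ⁰`, uniformiser `ϖ`, `σ` valuation-preserving; `J₀ = antidiag(1,…,1)`, `B₀ σ N` its pairing; `N₁ = latt diag(1,1,ϖ)`,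
`w(a,b) = (a∕ϖ, 0, b)`).  (§1) The dual of a DIAGONAL lattice for `J₀` sees only valuations: `(latt diag(d))^♯ = latt diag((d ∘ rev)⁻¹)` for ANY valuation-preserving `σ`
— no hypothesis on `σϖ` (test vectors `d_{rev i}·e_{rev i}`; ultrametric inequality).  Hence `N₁^♯ = latt diag(ϖ⁻¹,1,1)` and `Stab_U(N₁)` fixes `N₁^♯` (★ `dualLatt_mapGL`), and
p06's fixed-point test `γ·(N₁ + 𝒪w(a,b)) = N₁ + 𝒪w(a,b) ↔ ∃ c ∈ 𝒪^×, |γ₀₀a + ϖγ₀₂b − ca| < 1 ∧ |ϖ⁻¹γ₂₀a + γ₂₂b − cb| < 1` holds VERBATIM with hypotheses `(hvσ) (hϖ)` only (§2) —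
one statement serving the unramified and the ramified places at once.  (§3) At a TAMELY RAMIFIED place (`σϖ = −ϖ`, `σ` trivial on the residue field: `|σx − x| < 1` for
`|x| ≤ 1`) the residual form `ϖ·B₀` on `N₁^♯ ∕ N₁ ≅ 𝓀²` is ALTERNATING: `ϖ·B₀(w(a,b), w(a,b)) = σ(b)a − σ(a)b ∈ 𝔪`.  Consequently **EVERY primitive neighbour `N₁ + 𝒪w(a,b)` is a
SELF-DUAL vertex** (`|a| = 1`: `L = latt [w | e₁ | ϖe₂]` with Gram matrix `[[(σ(b)a − σ(a)b)∕ϖ, 0, −σa],[0, 1, 0],[−a, 0, 0]]`, integral of unit determinant `−σ(a)a`; `|a| < 1`: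
`L = 𝒪³`, self-dual by ★ `isSelfDualLattice_stdLattice`) — there is no isotropy condition at a ramified place, which is what makes S-a3-ram SIMPLER than S-a3.
HONEST LABEL: HC_CM is proved only modulo the 2 remaining named inputs (hLiu418 24832, h413 24833) until rung 0 closes; nothing printed is asserted here (elementary lattice
algebra over a valuation ring); S3 (`stub_N6nsS3id`) stays a print row until the road's END lands.

* §1 **`dualLatt_latt_diagonal_antidiagonal`** (any `N`, `σ` valuation-preserving), `dualLatt_N₁_of_v`, **`mapGL_dual_N₁_eq_of_v`**.
* §2 **`mapGL_N₁_sup_span_vec_eq_iff_of_v`** (the type-two fixed-star test in coordinates, `σϖ`-free).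
* §3 `v_sub_mul_lt_one_of_ramified` (the alternating residual pairing), **`isSelfDualLattice_N₁_sup_span_vec_of_neg`** (every primitive neighbour of `N₁` is self-dual at a ramified place).

## References
* [BruhatTits1972] F. Bruhat, J. Tits, *Groupes réductifs sur un corps local I*, Publ. Math. IHÉS 41 (1972), §10 (lattice models; the star of a vertex = the residual building).
* [Tits1979] J. Tits, *Reductive groups over local fields*, PSPM 33.1 (1979), §3.5 (reduction mod `𝔭`), §1.15 / §3.11 (the ramified unitary group in three variables).
* [Jacobowitz1962] R. Jacobowitz, *Hermitian forms over local fields*, Amer. J. Math. 84 (1962), §4 (duals), §7–§8 (unimodular ∕ modular hermitian lattices, ramified case).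
* [Serre1980Trees] J.-P. Serre, *Trees* (1980), Ch. II §1.1 (neighbours of a lattice = lines of its reduction).
-/

set_option autoImplicit false

noncomputable section

open scoped Valued WithZero Matrix MatrixGroups

namespace Literature.NumberTheory.Automorphic.UnitaryLatticeTree

open Literature.NumberTheory.Automorphic Literature.NumberTheory.Automorphic.HermitianLattice

variable {K : Type*} [Field K] [Valued K ℤᵐ⁰]

section Coordinates

variable {σ : K →+* K} {ϖ : K}

/-! ## §1 The dual of a diagonal lattice for `J₀` — no hypothesis on `σϖ` -/

/-- **The dual of a diagonal lattice for the antidiagonal form sees only valuations**: for `σ` valuation-preserving and `d_i ≠ 0`,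
`(latt diag(d))^♯ = latt diag((d_{rev i})⁻¹)` — NO hypothesis on `σϖ` (so it serves ramified places too).  (⊆) test against `d_{rev i}·e_{rev i} ∈ latt diag(d)`;
(⊇) the ultrametric inequality. [cite: Jacobowitz1962, §4] [cite: BruhatTits1972, §10] -/
theorem dualLatt_latt_diagonal_antidiagonal {N : ℕ} (hvσ : ∀ a, Valued.v (σ a) = Valued.v a) {d : Fin N → K} (hd : ∀ i, d i ≠ 0) :
    dualLatt σ ((StdForm.antidiagonal N).over K) (latt (Matrix.diagonal d)) = latt (Matrix.diagonal fun i => (d (Fin.rev i))⁻¹) := by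
  have hd' : ∀ i, (fun i => (d (Fin.rev i))⁻¹) i ≠ 0 := fun i => inv_ne_zero (hd _)
  ext x
  rw [mem_dualLatt, mem_latt_diagonal_iff hd']
  constructor
  · intro h i
    have hvd : Valued.v (d (Fin.rev i)) ≠ 0 := (Valuation.ne_zero_iff _).2 (hd _)
    -- test vector `y = d_{rev i} · e_{rev i}`
    have hy : (Pi.single (Fin.rev i) (d (Fin.rev i)) : Fin N → K) ∈ latt (Matrix.diagonal d) := by
      refine (mem_latt_diagonal_iff hd _).2 fun j => ?_
      by_cases hj : j = Fin.rev i
      · subst hj; rw [Pi.single_eq_same]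
      · rw [Pi.single_eq_of_ne hj, map_zero]; exact zero_le
    have h1 := h _ hy
    rw [pairing_antidiagonal, B₀_apply, Finset.sum_eq_single (Fin.rev i), Pi.single_eq_same, Fin.rev_rev, map_mul, hvσ] at h1
    · rw [map_inv₀]
      calc Valued.v (x i) = (Valued.v (d (Fin.rev i)))⁻¹ * (Valued.v (d (Fin.rev i)) * Valued.v (x i)) := by
            rw [← mul_assoc, inv_mul_cancel₀ hvd, one_mul]
        _ ≤ (Valued.v (d (Fin.rev i)))⁻¹ * 1 := mul_le_mul' le_rfl h1
        _ = (Valued.v (d (Fin.rev i)))⁻¹ := mul_one _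
    · intro j _ hj; rw [Pi.single_eq_of_ne hj, map_zero, zero_mul]
    · intro hi; exact absurd (Finset.mem_univ _) hi
  · intro hx y hy
    rw [mem_latt_diagonal_iff hd] at hy
    rw [pairing_antidiagonal, B₀_apply]
    refine Valuation.map_sum_le _ fun j _ => ?_
    have hvd : Valued.v (d j) ≠ 0 := (Valuation.ne_zero_iff _).2 (hd _)
    have h2 := hx (Fin.rev j)
    simp only [Fin.rev_rev, map_inv₀] at h2
    rw [map_mul, hvσ]
    calc Valued.v (y j) * Valued.v (x (Fin.rev j)) ≤ Valued.v (d j) * (Valued.v (d j))⁻¹ := mul_le_mul' (hy j) h2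
      _ = 1 := mul_inv_cancel₀ hvd

/-- **`N₁^♯ = latt diag(ϖ⁻¹, 1, 1)`** for ANY valuation-preserving `σ` (no hypothesis on `σϖ`). [cite: Jacobowitz1962, §4] -/
theorem dualLatt_N₁_of_v (hvσ : ∀ a, Valued.v (σ a) = Valued.v a) (hϖ0 : ϖ ≠ 0) :
    dualLatt σ ((StdForm.antidiagonal 3).over K) (latt (Matrix.diagonal ![(1 : K), 1, ϖ])) = latt (Matrix.diagonal ![ϖ⁻¹, (1 : K), 1]) := by
  have hd' : ∀ i, (![(1 : K), 1, ϖ] : Fin 3 → K) i ≠ 0 := by intro i; fin_cases i <;> simp [hϖ0]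
  rw [dualLatt_latt_diagonal_antidiagonal hvσ hd']
  congr 2; funext i; fin_cases i <;> simp [Fin.rev]

/-- **`Stab(N₁)` fixes `N₁^♯`** for ANY valuation-preserving `σ`: for `γ ∈ U(σ, J₀)` with `γ·N₁ = N₁`, `γ·latt diag(ϖ⁻¹,1,1) = latt diag(ϖ⁻¹,1,1)` (★ `dualLatt_mapGL`).
The `σϖ`-free form of ★ `mapGL_dual_N₁_eq`. [cite: Jacobowitz1962, §4] [cite: BruhatTits1972, §10] -/
theorem mapGL_dual_N₁_eq_of_v (hvσ : ∀ a, Valued.v (σ a) = Valued.v a) (hϖ : Valued.v ϖ = WithZero.exp (-1 : ℤ))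
    (γ : unitaryGroupOfForm σ ((StdForm.antidiagonal 3).over K))
    (hγ : mapGL (γ : GL (Fin 3) K) (latt (Matrix.diagonal ![(1 : K), 1, ϖ])) = latt (Matrix.diagonal ![(1 : K), 1, ϖ])) :
    mapGL (γ : GL (Fin 3) K) (latt (Matrix.diagonal ![ϖ⁻¹, (1 : K), 1])) = latt (Matrix.diagonal ![ϖ⁻¹, (1 : K), 1]) := by
  have hϖ0 : ϖ ≠ 0 := fun h0 => by rw [h0, map_zero] at hϖ; exact WithZero.coe_ne_zero hϖ.symm
  rw [← dualLatt_N₁_of_v hvσ hϖ0, ← dualLatt_mapGL γ.2, hγ]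

/-! ## §2 The type-two fixed-star test in coordinates — `σϖ`-free -/

/-- **THE TYPE-TWO FIXED-STAR TEST IN COORDINATES, `σϖ`-FREE** (serves unramified and ramified places alike): for `σ` valuation-preserving, `γ ∈ U(σ, J₀)` with `γ·N₁ = N₁`
and a PRIMITIVE `(a, b) ∈ 𝒪²`, `γ·(N₁ + 𝒪w(a,b)) = N₁ + 𝒪w(a,b) ↔ ∃ c, |c| = 1 ∧ |γ₀₀a + ϖγ₀₂b − c·a| < 1 ∧ |ϖ⁻¹γ₂₀a + γ₂₂b − c·b| < 1` — the residual matrix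
`[[γ₀₀, ϖγ₀₂],[ϖ⁻¹γ₂₀, γ₂₂]]` fixes `[ā : b̄] ∈ ℙ¹(𝓀)`.  Proof = ★ `mapGL_N₁_sup_span_vec_eq_iff` with ★ `mapGL_dual_N₁_eq` replaced by `mapGL_dual_N₁_eq_of_v`.
[cite: BruhatTits1972, §10] [cite: Tits1979, §3.5] -/
theorem mapGL_N₁_sup_span_vec_eq_iff_of_v (hvσ : ∀ a, Valued.v (σ a) = Valued.v a) (hϖ : Valued.v ϖ = WithZero.exp (-1 : ℤ))
    (γ : unitaryGroupOfForm σ ((StdForm.antidiagonal 3).over K))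
    (hγ : mapGL (γ : GL (Fin 3) K) (latt (Matrix.diagonal ![(1 : K), 1, ϖ])) = latt (Matrix.diagonal ![(1 : K), 1, ϖ]))
    {a b : K} (ha : Valued.v a ≤ 1) (hb : Valued.v b ≤ 1) (hprim : Valued.v a = 1 ∨ Valued.v b = 1) :
    mapGL (γ : GL (Fin 3) K) (latt (Matrix.diagonal ![(1 : K), 1, ϖ]) ⊔ Submodule.span 𝒪[K] {(![a / ϖ, 0, b] : Fin 3 → K)}) =
        latt (Matrix.diagonal ![(1 : K), 1, ϖ]) ⊔ Submodule.span 𝒪[K] {(![a / ϖ, 0, b] : Fin 3 → K)} ↔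
      ∃ c : K, Valued.v c = 1 ∧
        Valued.v (((γ : GL (Fin 3) K) : Matrix (Fin 3) (Fin 3) K) 0 0 * a + ϖ * ((γ : GL (Fin 3) K) : Matrix (Fin 3) (Fin 3) K) 0 2 * b - c * a) < 1 ∧
        Valued.v (ϖ⁻¹ * ((γ : GL (Fin 3) K) : Matrix (Fin 3) (Fin 3) K) 2 0 * a + ((γ : GL (Fin 3) K) : Matrix (Fin 3) (Fin 3) K) 2 2 * b - c * b) < 1 := by
  have hwM : (![a / ϖ, 0, b] : Fin 3 → K) ∉ latt (Matrix.diagonal ![(1 : K), 1, ϖ]) := by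
    rw [vec_mem_N₁_iff hϖ a b]
    rintro ⟨ha', hb'⟩
    rcases hprim with h | h
    · exact (lt_irrefl _) (h ▸ ha')
    · exact (lt_irrefl _) (h ▸ hb')
  rw [mapGL_sup_span_eq_iff hϖ hγ (smul_ϖ_vec_mem_N₁ hϖ ha hb) hwM]
  obtain ⟨-, -, hcongr⟩ := mulVec_vec_sub_vec_mem_N₁ hϖ (γ := (γ : GL (Fin 3) K)) (mapGL_dual_N₁_eq_of_v hvσ hϖ γ hγ).le ha hb
  set a' := ((γ : GL (Fin 3) K) : Matrix (Fin 3) (Fin 3) K) 0 0 * a + ϖ * ((γ : GL (Fin 3) K) : Matrix (Fin 3) (Fin 3) K) 0 2 * b with ha'_def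
  set b' := ϖ⁻¹ * ((γ : GL (Fin 3) K) : Matrix (Fin 3) (Fin 3) K) 2 0 * a + ((γ : GL (Fin 3) K) : Matrix (Fin 3) (Fin 3) K) 2 2 * b with hb'_def
  refine exists_congr fun c => and_congr_right fun _ => ?_
  -- `γw − c w ≡ w(a′ − ca, b′ − cb) (mod N₁)`
  have hsplit : ((γ : GL (Fin 3) K) : Matrix (Fin 3) (Fin 3) K).mulVec ![a / ϖ, 0, b] - c • (![a / ϖ, 0, b] : Fin 3 → K) =
      (((γ : GL (Fin 3) K) : Matrix (Fin 3) (Fin 3) K).mulVec ![a / ϖ, 0, b] - ![a' / ϖ, 0, b']) + ![(a' - c * a) / ϖ, 0, b' - c * b] := by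
    have hvec : (![(a' - c * a) / ϖ, 0, b' - c * b] : Fin 3 → K) = ![a' / ϖ, 0, b'] - c • (![a / ϖ, 0, b] : Fin 3 → K) := by
      funext i; fin_cases i <;> simp
      ring
    rw [hvec, sub_add_sub_cancel]
  rw [hsplit, ← vec_mem_N₁_iff hϖ (a' - c * a) (b' - c * b)]
  constructor
  · intro h
    have := Submodule.sub_mem _ h hcongr
    rwa [add_sub_cancel_left] at this
  · intro h; exact Submodule.add_mem _ hcongr h

/-! ## §3 At a tamely ramified place every primitive neighbour of `N₁` is self-dual -/

/-- **The residual pairing is alternating at a ramified place**: if `σ` is valuation-preserving and trivial on the residue field (`|σx − x| < 1` for `|x| ≤ 1`), then for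
`a, b ∈ 𝒪`, `|σ(b)·a − σ(a)·b| < 1` (`σ(b)a − σ(a)b = (σb − b)a + (a − σa)b`). [cite: Jacobowitz1962, §8] [cite: Tits1979, §3.5] -/
theorem v_sub_mul_lt_one_of_ramified (hres : ∀ x : K, Valued.v x ≤ 1 → Valued.v (σ x - x) < 1)
    {a b : K} (ha : Valued.v a ≤ 1) (hb : Valued.v b ≤ 1) : Valued.v (σ b * a - σ a * b) < 1 := by
  have hsplit : σ b * a - σ a * b = (σ b - b) * a - (σ a - a) * b := by ring
  rw [hsplit]
  refine lt_of_le_of_lt (Valuation.map_sub _ _ _) (max_lt ?_ ?_)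
  · rw [map_mul]; exact lt_of_le_of_lt (mul_le_of_le_one_right' ha) (hres b hb)
  · rw [map_mul]; exact lt_of_le_of_lt (mul_le_of_le_one_right' hb) (hres a ha)

/-- **AT A TAMELY RAMIFIED PLACE EVERY PRIMITIVE NEIGHBOUR OF `N₁` IS A SELF-DUAL VERTEX**: `σ` valuation-preserving with `σϖ = −ϖ` and trivial residual action; for a
primitive `(a, b) ∈ 𝒪²` the superlattice `N₁ + 𝒪w(a,b)`, `w(a,b) = (a∕ϖ, 0, b)`, is self-dual for `J₀`.  `|a| = 1`: `L = latt g`, `g = [w | e₁ | ϖe₂]`, Gram matrix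
`(σg)ᵀ J₀ g = [[(σ(b)a − σ(a)b)∕ϖ, 0, −σa],[0, 1, 0],[−a, 0, 0]]` — integral (the corner by `v_sub_mul_lt_one_of_ramified`) of determinant `−σ(a)a`, a unit; `|a| < 1` (so
`|b| = 1`): `L = 𝒪³`, self-dual (★ `isSelfDualLattice_stdLattice`).  Contrast ★ `isSelfDualLattice_N₁_sup_span_vec_iff` (`σϖ = ϖ`: self-dual iff isotropic).
[cite: Jacobowitz1962, §7–§8] [cite: BruhatTits1972, §10] [cite: Serre1980Trees, II.1.1] -/
theorem isSelfDualLattice_N₁_sup_span_vec_of_neg (hvσ : ∀ a, Valued.v (σ a) = Valued.v a) (hσϖ : σ ϖ = -ϖ)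
    (hϖ : Valued.v ϖ = WithZero.exp (-1 : ℤ)) (hres : ∀ x : K, Valued.v x ≤ 1 → Valued.v (σ x - x) < 1)
    {a b : K} (ha : Valued.v a ≤ 1) (hb : Valued.v b ≤ 1) (hprim : Valued.v a = 1 ∨ Valued.v b = 1) :
    IsSelfDualLattice σ ϖ ((StdForm.antidiagonal 3).over K) (latt (Matrix.diagonal ![(1 : K), 1, ϖ]) ⊔ Submodule.span 𝒪[K] {(![a / ϖ, 0, b] : Fin 3 → K)}) := by
  have hϖ0 : ϖ ≠ 0 := fun h0 => by rw [h0, map_zero] at hϖ; exact WithZero.coe_ne_zero hϖ.symm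
  have hvϖ0 : Valued.v ϖ ≠ 0 := (Valuation.ne_zero_iff _).2 hϖ0
  have hϖ1 : Valued.v ϖ ≤ 1 := by rw [hϖ, ← WithZero.exp_zero]; exact WithZero.exp_le_exp.2 (by norm_num)
  have hlt : ∀ z : K, Valued.v z < 1 ↔ Valued.v z ≤ Valued.v ϖ := fun z => by rw [hϖ]; exact v_lt_one_iff z
  have hd' : ∀ i, (![(1 : K), 1, ϖ] : Fin 3 → K) i ≠ 0 := by intro i; fin_cases i <;> simp [hϖ0]
  have halt : Valued.v (σ b * a - σ a * b) < 1 := v_sub_mul_lt_one_of_ramified hres ha hb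
  -- `J₀` in coordinates
  have hJ : ∀ i j : Fin 3, (StdForm.antidiagonal 3).over K i j = if j = Fin.rev i then (1 : K) else 0 := by
    intro i j
    simp only [StdForm.over, Matrix.map_apply, StdForm.antidiagonal_J_apply]
    split_ifs <;> simp
  by_cases ha1 : Valued.v a = 1
  · -- `|a| = 1`: `L = latt g`, `g = [w | e₁ | ϖe₂]`
    have ha0 : a ≠ 0 := fun h0 => by rw [h0, map_zero] at ha1; exact zero_ne_one ha1
    set g : Matrix (Fin 3) (Fin 3) K := !![a / ϖ, 0, 0; 0, 1, 0; b, 0, ϖ] with hg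
    have hgdet : g.det = a := by rw [hg, Matrix.det_fin_three]; simp; field_simp
    have hgdet0 : g.det ≠ 0 := by rw [hgdet]; exact ha0
    have hcol0 : g.mulVec (Pi.single 0 1) = ![a / ϖ, 0, b] := by
      rw [Matrix.mulVec_single_one]; funext i; fin_cases i <;> simp [hg]
    have hcol1 : g.mulVec (Pi.single 1 1) = Pi.single 1 1 := by
      rw [Matrix.mulVec_single_one]; funext i; fin_cases i <;> simp [hg]
    have hcol2 : g.mulVec (Pi.single 2 1) = ϖ • Pi.single 2 1 := by
      rw [Matrix.mulVec_single_one]; funext i; fin_cases i <;> simp [hg]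
    have hL : latt (Matrix.diagonal ![(1 : K), 1, ϖ]) ⊔ Submodule.span 𝒪[K] {(![a / ϖ, 0, b] : Fin 3 → K)} = latt g := by
      apply le_antisymm
      · refine sup_le ((latt_le_iff_forall_mulVec_single_mem _ _).2 fun j => ?_) ((Submodule.span_singleton_le_iff_mem _ _).2 ?_)
        · fin_cases j
          · -- `e₀ = (ϖ∕a)·w − (b∕a)·(ϖe₂)`
            have hmem : ((⟨ϖ / a, (Valuation.mem_integer_iff _ _).2 (by rw [map_div₀, ha1, div_one]; exact hϖ1)⟩ : 𝒪[K]) • g.mulVec (Pi.single 0 1) -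
                (⟨b / a, (Valuation.mem_integer_iff _ _).2 (by rw [map_div₀, ha1, div_one]; exact hb)⟩ : 𝒪[K]) • g.mulVec (Pi.single 2 1)) ∈ latt g :=
              Submodule.sub_mem _ (Submodule.smul_mem _ _ (mulVec_single_mem_latt g 0)) (Submodule.smul_mem _ _ (mulVec_single_mem_latt g 2))
            have heq : ((⟨ϖ / a, (Valuation.mem_integer_iff _ _).2 (by rw [map_div₀, ha1, div_one]; exact hϖ1)⟩ : 𝒪[K]) • g.mulVec (Pi.single 0 1) -
                (⟨b / a, (Valuation.mem_integer_iff _ _).2 (by rw [map_div₀, ha1, div_one]; exact hb)⟩ : 𝒪[K]) • g.mulVec (Pi.single 2 1) : Fin 3 → K) =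
                (Matrix.diagonal ![(1 : K), 1, ϖ]).mulVec (Pi.single 0 1) := by
              change (ϖ / a) • g.mulVec (Pi.single 0 1) - (b / a) • g.mulVec (Pi.single 2 1) = _
              rw [hcol0, hcol2, Matrix.mulVec_single_one]
              funext i; fin_cases i <;> simp <;> field_simp
              ring
            rw [Fin.zero_eta, ← heq]; exact hmem
          · have : (Matrix.diagonal ![(1 : K), 1, ϖ]).mulVec (Pi.single 1 1) = g.mulVec (Pi.single 1 1) := by
              rw [hcol1, Matrix.mulVec_single_one]; funext i; fin_cases i <;> simp
            rw [Fin.mk_one, this]; exact mulVec_single_mem_latt g 1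
          · have : (Matrix.diagonal ![(1 : K), 1, ϖ]).mulVec (Pi.single 2 1) = g.mulVec (Pi.single 2 1) := by
              rw [hcol2, Matrix.mulVec_single_one]; funext i; fin_cases i <;> simp
            simp only [Fin.reduceFinMk]; rw [this]; exact mulVec_single_mem_latt g 2
        · rw [← hcol0]; exact mulVec_single_mem_latt g 0
      · refine (latt_le_iff_forall_mulVec_single_mem _ _).2 fun j => ?_
        fin_cases j
        · rw [Fin.zero_eta, hcol0]; exact Submodule.mem_sup_right (Submodule.mem_span_singleton_self _)
        · rw [Fin.mk_one, hcol1]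
          exact Submodule.mem_sup_left ((mem_latt_diagonal_iff hd' _).2 fun i => by fin_cases i <;> simp)
        · simp only [Fin.reduceFinMk]; rw [hcol2]
          exact Submodule.mem_sup_left ((mem_latt_diagonal_iff hd' _).2 fun i => by fin_cases i <;> simp)
    rw [hL]
    -- the Gram matrix of `g` (ramified: `σ(a∕ϖ) = −σa∕ϖ`, `σϖ = −ϖ`)
    have hG : formCongr σ (Matrix.GeneralLinearGroup.mkOfDetNeZero _ hgdet0) ((StdForm.antidiagonal 3).over K) =
        !![(σ b * a - σ a * b) / ϖ, 0, -σ a; 0, 1, 0; -a, 0, 0] := by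
      rw [formCongr, Matrix.GeneralLinearGroup.val_mkOfDetNeZero]
      ext i j
      fin_cases i <;> fin_cases j <;> simp [Matrix.mul_apply, Fin.sum_univ_three, hg, hJ, hσϖ, Fin.rev, Matrix.map_apply, map_div₀] <;> field_simp
      ring
    have hGdet : (!![(σ b * a - σ a * b) / ϖ, 0, -σ a; 0, 1, 0; -a, 0, 0] : Matrix (Fin 3) (Fin 3) K).det = -(σ a * a) := by
      rw [Matrix.det_fin_three]; simp
    have hGint : IsIntMatrix (!![(σ b * a - σ a * b) / ϖ, 0, -σ a; 0, 1, 0; -a, 0, 0] : Matrix (Fin 3) (Fin 3) K) := by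
      intro i j
      fin_cases i <;> fin_cases j <;> simp [hvσ, ha]
      rw [div_le_one₀ (zero_lt_iff.2 hvϖ0)]; exact (hlt _).1 halt
    have hvdet : Valued.v (!![(σ b * a - σ a * b) / ϖ, 0, -σ a; 0, 1, 0; -a, 0, 0] : Matrix (Fin 3) (Fin 3) K).det = 1 := by
      rw [hGdet, Valuation.map_neg, map_mul, hvσ, ha1, one_mul]
    refine ⟨Matrix.GeneralLinearGroup.mkOfDetNeZero _ hgdet0, by rw [Matrix.GeneralLinearGroup.val_mkOfDetNeZero], ?_, ?_, ?_⟩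
    · rw [hG]; exact hGint
    · rw [hG]; intro i j; rw [Matrix.smul_apply, smul_eq_mul, map_mul]; exact mul_le_one' hϖ1 (isIntMatrix_nonsing_inv_of_v_det_eq_one hGint hvdet i j)
    · rw [hG, hvdet, pow_zero]
  · -- `|a| < 1`, hence `|b| = 1` (primitive): `L = 𝒪³ = L₀`
    have hb1 : Valued.v b = 1 := hprim.resolve_left ha1
    have halt' : Valued.v a < 1 := lt_of_le_of_ne ha ha1
    have hb0 : b ≠ 0 := fun h0 => by rw [h0, map_zero] at hb1; exact zero_ne_one hb1
    have hL : latt (Matrix.diagonal ![(1 : K), 1, ϖ]) ⊔ Submodule.span 𝒪[K] {(![a / ϖ, 0, b] : Fin 3 → K)} = stdLattice K 3 := by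
      apply le_antisymm
      · refine sup_le (scaleLattice_stdLattice_le_N₁_le hϖ1 hϖ0).2 ((Submodule.span_singleton_le_iff_mem _ _).2 fun i => ?_)
        fin_cases i
        · simp only [Fin.zero_eta, Matrix.cons_val_zero, map_div₀, div_le_one₀ (zero_lt_iff.2 hvϖ0)]; exact (hlt _).1 halt'
        · simp
        · simpa using hb
      · -- `𝒪³ = latt 1`; `e₀, e₁ ∈ N₁`, `e₂ = b⁻¹·(w − (a∕ϖ)·e₀)`
        rw [← latt_one]
        refine (latt_le_iff_forall_mulVec_single_mem _ _).2 fun j => ?_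
        rw [Matrix.one_mulVec]
        fin_cases j
        · exact Submodule.mem_sup_left ((mem_latt_diagonal_iff hd' _).2 fun i => by fin_cases i <;> simp)
        · exact Submodule.mem_sup_left ((mem_latt_diagonal_iff hd' _).2 fun i => by fin_cases i <;> simp)
        · have haϖ : Valued.v (a / ϖ) ≤ 1 := by rw [map_div₀, div_le_one₀ (zero_lt_iff.2 hvϖ0)]; exact (hlt _).1 halt'
          have hbinv : Valued.v b⁻¹ ≤ 1 := by rw [map_inv₀, hb1, inv_one]
          have hmem : ((⟨b⁻¹, (Valuation.mem_integer_iff _ _).2 hbinv⟩ : 𝒪[K]) •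
              ((![a / ϖ, 0, b] : Fin 3 → K) - (⟨a / ϖ, (Valuation.mem_integer_iff _ _).2 haϖ⟩ : 𝒪[K]) • (![1, 0, 0] : Fin 3 → K))) ∈
              latt (Matrix.diagonal ![(1 : K), 1, ϖ]) ⊔ Submodule.span 𝒪[K] {(![a / ϖ, 0, b] : Fin 3 → K)} :=
            Submodule.smul_mem _ _ (Submodule.sub_mem _ (Submodule.mem_sup_right (Submodule.mem_span_singleton_self _))
              (Submodule.smul_mem _ _ (Submodule.mem_sup_left ((mem_latt_diagonal_iff hd' _).2 fun i => by fin_cases i <;> simp))))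
          have heq : ((⟨b⁻¹, (Valuation.mem_integer_iff _ _).2 hbinv⟩ : 𝒪[K]) •
              ((![a / ϖ, 0, b] : Fin 3 → K) - (⟨a / ϖ, (Valuation.mem_integer_iff _ _).2 haϖ⟩ : 𝒪[K]) • (![1, 0, 0] : Fin 3 → K)) : Fin 3 → K) =
              ![0, 0, 1] := by
            change b⁻¹ • ((![a / ϖ, 0, b] : Fin 3 → K) - (a / ϖ) • (![1, 0, 0] : Fin 3 → K)) = ![0, 0, 1]
            funext i; fin_cases i <;> simp [hb0]
          have hsingle : (Pi.single 2 1 : Fin 3 → K) = ![0, 0, 1] := by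
            funext i; fin_cases i <;> simp
          simp only [Fin.reduceFinMk]; rw [hsingle, ← heq]; exact hmem
    rw [hL]
    refine isSelfDualLattice_stdLattice (fun i j => ?_) (fun i j => ?_) ?_ hϖ1
    · rw [hJ]; split_ifs <;> simp
    · rw [StdForm.inv_over, hJ]; split_ifs <;> simp
    · have hdet : ((StdForm.antidiagonal 3).over K).det = -1 := by
        rw [Matrix.det_fin_three]; simp [hJ, Fin.rev]
      rw [hdet, Valuation.map_neg, map_one]

end Coordinates

end Literature.NumberTheory.Automorphic.UnitaryLatticeTree

end
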